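import Summits.QuantumAdvantage.QuantumAdvantage.Theorems.CubicForrelationNearExactIsExactTwelveZ512SignAffine

/-!
# Crux `CubicForrelation.NearExactIsExact` (stmt-QuantumAdvantage-14043) — n = 12, level-`≥ 6` side with a 9-flat even set on the OPEN
  window: the LINE congruence at off-flat energy `≤ 383` and the dichotomy "`4 ∣ e` off `Z` or off-flat energy `≥ 256`"

Certificate seat `b2b-cforr-cert` (gen 27).  HONEST FRAMING: finite-slice lemmas (standard axioms) about cubic Boolean pairs on 12 bits; bricks for
the partner-free half of "no level-`≥ 6` side on the open window `57/64 < Φ < 29/32`" (…TwelveZ512H4, …TwelveZ512PiBound).  NO value of `θ₁₂` is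
claimed; NOT summit progress.

Setting.  Cubic `f, g`, `W_g = 64u''`, `e := u'' − (−1)^f`, `Z := {u'' even} = x_Z ⊕ V₀` a 9-flat, `A₂ := {x ∉ Z : 4 ∤ e(x)}` (off `Z` the residual is
even; `4·#A₂ ≤ E_off := Σ_{x∉Z} e²`).
* `tzc_sum4_split`, `tzc_four_flat_Z`: a parametrised 4-flat sum is four 2-flat sums, so (…TwelveZ512SignAffine, `tza_two_flat`)
  `4 ∣ Σ_{4-flat ⊂ Z} e` whenever `E_off ≤ 511`.
* `tzc_line`: for EVERY base point `b` and directions `a₀..a₃ ∈ V₀`, `4 ∣ Σ_ε e(b ⊕ ε·a)` whenever `E_off ≤ 383` — gen 25's `gh_line` needed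
  `E_off ≤ 256`; here the 6-flat `x_Z ⊕ ⟨x_Z⊕b, t₂, a⟩` is used with ONE avoiding direction `t₂` (forbidden `2·(512 + 16·95) = 4064 < 4096`).
* `tzc_A2_coset`: hence `A₂` meets every off-`Z` coset in `0` or `≥ 64` points (`ws_erm_round`, `r = 3` on the 9-dimensional coset);
  `tzc_A2_energy`: EITHER `4 ∣ e` everywhere off `Z`, OR `E_off ≥ 256`.

References: J. Ax (1964) / R. J. McEliece (1972); MacWilliams–Sloane (1977) Ch. 13 §3; R. O'Donnell (2014) §3.3.  Axioms: the standard three.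
-/

set_option linter.dupNamespace false -- D-0017: single-problem summit ⇒ `QuantumAdvantage.QuantumAdvantage` by design

noncomputable section

namespace Summit.QuantumAdvantage.QuantumAdvantage.Theorems.CubicForrelation.NearExactIsExact

open Finset
open Literature.Computability.QuantumComplexity
open Literature.Computability.QuantumComplexity.BuzetChailloux (bxor zeroVec bxor_bxor_cancel_left bxor_zeroVec zeroVec_bxor bxor_comm
  bxor_self)
open Literature.Computability.QuantumComplexity.DerivativeWalsh (W)

/-! ### Bookkeeping: translates of flat points, the 4-flat sum as four 2-flat sums -/

/-- Translating a parametrised flat point translates its base. [folklore] -/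
theorem tzc_flatPt_translate {k : ℕ} (x t : Fin (6 + 6) → Bool) (a : Fin k → Fin (6 + 6) → Bool) (ε : Fin k → Bool) :
    bxor (fun j => x j ^^ decide (Odd #(univ.filter fun i => ε i && a i j))) t =
      (fun j => (bxor x t) j ^^ decide (Odd #(univ.filter fun i => ε i && a i j))) := by
  rw [ws_flatPt_eq_bxor x, ws_flatPt_eq_bxor (bxor x t)]
  funext j; simp only [bxor]; cases x j <;> cases t j <;> simp

/-- **A parametrised 4-flat sum is four parametrised 2-flat sums** (bases `x, x⊕a₁, x⊕a₀, x⊕a₀⊕a₁`, directions `a₂, a₃`). [folklore] -/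
theorem tzc_sum4_split (F : (Fin (6 + 6) → Bool) → ℤ) (x a₀ a₁ a₂ a₃ : Fin (6 + 6) → Bool) :
    ∑ ε : Fin 4 → Bool, F (fun j => x j ^^ decide (Odd #(univ.filter fun i => ε i && (![a₀, a₁, a₂, a₃] : Fin 4 → Fin (6 + 6) → Bool) i j))) =
      (∑ ε : Fin 2 → Bool, F (fun j => x j ^^ decide (Odd #(univ.filter fun i => ε i && (![a₂, a₃] : Fin 2 → Fin (6 + 6) → Bool) i j))) +
        ∑ ε : Fin 2 → Bool, F (fun j => (bxor x a₁) j ^^ decide (Odd #(univ.filter fun i => ε i && (![a₂, a₃] : Fin 2 → Fin (6 + 6) → Bool) i j)))) +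
      (∑ ε : Fin 2 → Bool, F (fun j => (bxor x a₀) j ^^ decide (Odd #(univ.filter fun i => ε i && (![a₂, a₃] : Fin 2 → Fin (6 + 6) → Bool) i j))) +
        ∑ ε : Fin 2 → Bool, F (fun j => (bxor (bxor x a₀) a₁) j ^^ decide (Odd #(univ.filter fun i => ε i && (![a₂, a₃] : Fin 2 → Fin (6 + 6) → Bool) i j)))) := by
  have e4 : (![a₀, a₁, a₂, a₃] : Fin 4 → Fin (6 + 6) → Bool) = Matrix.vecCons a₀ ![a₁, a₂, a₃] := rfl
  have e3 : (![a₁, a₂, a₃] : Fin 3 → Fin (6 + 6) → Bool) = Matrix.vecCons a₁ ![a₂, a₃] := rfl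
  rw [e4, fr_sum_peel F x a₀ ![a₁, a₂, a₃]]
  rw [sum_congr rfl fun ε _ => congrArg F (tzc_flatPt_translate x a₀ ![a₁, a₂, a₃] ε)]
  rw [e3, fr_sum_peel F x a₁ ![a₂, a₃], fr_sum_peel F (bxor x a₀) a₁ ![a₂, a₃]]
  rw [sum_congr rfl fun ε _ => congrArg F (tzc_flatPt_translate x a₁ ![a₂, a₃] ε),
    sum_congr rfl fun ε _ => congrArg F (tzc_flatPt_translate (bxor x a₀) a₁ ![a₂, a₃] ε)]

/-! ### `4 ∣` every 4-flat sum inside `Z` -/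

/-- **`4 ∣ Σ_{4-flat ⊂ Z} e`** for a level-`≥ 6` side with a 9-flat even set and off-flat energy `≤ 511` (four 2-flat congruences).
[this work] -/
theorem tzc_four_flat_Z (f g : (Fin (6 + 6) → Bool) → Bool) (hf : IsDegLeFun 3 f) (hg : IsDegLeFun 3 g)
    (u'' : (Fin (6 + 6) → Bool) → ℤ) (hu'' : ∀ x, W (fun y => signOf (g y)) x = (2 : ℝ) ^ 6 * (u'' x : ℝ))
    (V₀ : Finset (Fin (6 + 6) → Bool)) (xZ : Fin (6 + 6) → Bool) (h0 : zeroVec ∈ V₀)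
    (hadd : ∀ a ∈ V₀, ∀ b ∈ V₀, bxor a b ∈ V₀) (hcardV : #V₀ = 512)
    (hS : (univ.filter fun x : Fin (6 + 6) → Bool => ¬ Odd (u'' x)) = V₀.image (bxor xZ))
    (hoff : ∑ y ∈ univ.filter (fun y => y ∉ (univ.filter fun x : Fin (6 + 6) → Bool => ¬ Odd (u'' x))), (u'' y - sZ (f y)) ^ 2 ≤ 511)
    (x : Fin (6 + 6) → Bool) (hx : x ∈ (univ.filter fun x : Fin (6 + 6) → Bool => ¬ Odd (u'' x)))
    (a₀ a₁ a₂ a₃ : Fin (6 + 6) → Bool) (ha₀ : a₀ ∈ V₀) (ha₁ : a₁ ∈ V₀) (ha₂ : a₂ ∈ V₀) (ha₃ : a₃ ∈ V₀) :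
    (4 : ℤ) ∣ ∑ ε : Fin 4 → Bool, (u'' (fun j => x j ^^ decide (Odd #(univ.filter fun i =>
        ε i && (![a₀, a₁, a₂, a₃] : Fin 4 → Fin (6 + 6) → Bool) i j))) - sZ (f (fun j => x j ^^ decide (Odd #(univ.filter fun i =>
        ε i && (![a₀, a₁, a₂, a₃] : Fin 4 → Fin (6 + 6) → Bool) i j))))) := by
  classical
  set Z := univ.filter (fun x : Fin (6 + 6) → Bool => ¬ Odd (u'' x)) with hZdef
  set e : (Fin (6 + 6) → Bool) → ℤ := fun x => u'' x - sZ (f x) with hedef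
  have hPV : ∀ x, x ∈ Z → ∀ a ∈ V₀, bxor x a ∈ Z := fun x hx a ha => fl1_coset_vadd hadd hS hx ha
  have H2 := tza_two_flat f g hf hg u'' hu'' V₀ xZ h0 hadd hcardV hS hoff
  show (4 : ℤ) ∣ ∑ ε : Fin 4 → Bool, e (fun j => x j ^^ decide (Odd #(univ.filter fun i =>
        ε i && (![a₀, a₁, a₂, a₃] : Fin 4 → Fin (6 + 6) → Bool) i j)))
  rw [tzc_sum4_split e x a₀ a₁ a₂ a₃]
  refine dvd_add (dvd_add (H2 x hx a₂ a₃ ha₂ ha₃) (H2 _ (hPV x hx a₁ ha₁) a₂ a₃ ha₂ ha₃))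
    (dvd_add (H2 _ (hPV x hx a₀ ha₀) a₂ a₃ ha₂ ha₃) (H2 _ (hPV _ (hPV x hx a₀ ha₀) a₁ ha₁) a₂ a₃ ha₂ ha₃))

/-! ### The LINE congruence at off-flat energy `≤ 383` -/

/-- **Every 4-flat with directions in `V₀` has residual sum `≡ 0 (mod 4)`** (any base point), for a level-`≥ 6` side with a 9-flat even
set and off-flat energy `≤ 383` (gen 25's `gh_line` at `≤ 256`, with the larger avoidance count `2·(512 + 16·95) < 4096`). [this work] -/
theorem tzc_line (f g : (Fin (6 + 6) → Bool) → Bool) (hf : IsDegLeFun 3 f) (hg : IsDegLeFun 3 g)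
    (u'' : (Fin (6 + 6) → Bool) → ℤ) (hu'' : ∀ x, W (fun y => signOf (g y)) x = (2 : ℝ) ^ 6 * (u'' x : ℝ))
    (V₀ : Finset (Fin (6 + 6) → Bool)) (xZ : Fin (6 + 6) → Bool) (h0 : zeroVec ∈ V₀)
    (hadd : ∀ a ∈ V₀, ∀ b ∈ V₀, bxor a b ∈ V₀) (hcardV : #V₀ = 512)
    (hS : (univ.filter fun x : Fin (6 + 6) → Bool => ¬ Odd (u'' x)) = V₀.image (bxor xZ))
    (hoff : ∑ y ∈ univ.filter (fun y => y ∉ (univ.filter fun x : Fin (6 + 6) → Bool => ¬ Odd (u'' x))), (u'' y - sZ (f y)) ^ 2 ≤ 383)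
    (b : Fin (6 + 6) → Bool)
    (a₀ a₁ a₂ a₃ : Fin (6 + 6) → Bool) (ha₀ : a₀ ∈ V₀) (ha₁ : a₁ ∈ V₀) (ha₂ : a₂ ∈ V₀) (ha₃ : a₃ ∈ V₀) :
    (4 : ℤ) ∣ ∑ ε : Fin 4 → Bool, (u'' (fun j => b j ^^ decide (Odd #(univ.filter fun i =>
        ε i && (![a₀, a₁, a₂, a₃] : Fin 4 → Fin (6 + 6) → Bool) i j))) - sZ (f (fun j => b j ^^ decide (Odd #(univ.filter fun i =>
        ε i && (![a₀, a₁, a₂, a₃] : Fin 4 → Fin (6 + 6) → Bool) i j))))) := by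
  classical
  set Z := univ.filter (fun x : Fin (6 + 6) → Bool => ¬ Odd (u'' x)) with hZdef
  set e : (Fin (6 + 6) → Bool) → ℤ := fun x => u'' x - sZ (f x) with hedef
  show (4 : ℤ) ∣ ∑ ε : Fin 4 → Bool, e (fun j => b j ^^ decide (Odd #(univ.filter fun i =>
        ε i && (![a₀, a₁, a₂, a₃] : Fin 4 → Fin (6 + 6) → Bool) i j)))
  set A := (univ.filter fun y : Fin (6 + 6) → Bool => y ∉ Z ∧ ¬ (4 : ℤ) ∣ u'' y - sZ (f y)) with hAdef
  have hAcard : #A ≤ 95 := by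
    have h := gh_A_card f u''
    have h' : (4 : ℤ) * #A ≤ 383 := h.trans hoff
    have : (#A : ℤ) ≤ 95 := by omega
    exact_mod_cast this
  have hxZ : xZ ∈ Z := by rw [hS]; exact mem_image.2 ⟨zeroVec, h0, bxor_zeroVec xZ⟩
  have hPV : ∀ x, x ∈ Z → ∀ a ∈ V₀, bxor x a ∈ Z := fun x hx a ha => fl1_coset_vadd hadd hS hx ha
  have hoff' : ∑ y ∈ univ.filter (fun y => y ∉ Z), e y ^ 2 ≤ 511 := hoff.trans (by norm_num)
  -- the truncation
  set F' : (Fin (6 + 6) → Bool) → ℤ := fun y => if (y ∈ Z ∨ ¬ (4 : ℤ) ∣ e y) then e y else 0 with hF'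
  have hdiffF : ∀ y, (4 : ℤ) ∣ e y - F' y := by
    intro y
    by_cases hy : (y ∈ Z ∨ ¬ (4 : ℤ) ∣ e y)
    · simp only [F', if_pos hy, sub_self]; exact dvd_zero _
    · simp only [F', if_neg hy, sub_zero]
      rw [not_or, not_not] at hy
      exact hy.2
  have hF'Z : ∀ y, y ∈ Z → F' y = e y := fun y hy => by simp only [F', if_pos (Or.inl hy)]
  have hGF : ∀ y, y ∉ Z → y ∉ A → F' y = 0 := by
    intro y hy hyA
    have h4 : (4 : ℤ) ∣ e y := by
      by_contra h4
      exact hyA (mem_filter.2 ⟨mem_univ _, hy, h4⟩)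
    simp only [F']
    rw [if_neg]
    rw [not_or, not_not]
    exact ⟨hy, h4⟩
  -- the inner 4-flat in `Z` and its translate by `t₁ = x_Z ⊕ b`
  set pt : (Fin 4 → Bool) → (Fin (6 + 6) → Bool) :=
    fun ε => (fun j => xZ j ^^ decide (Odd #(univ.filter fun i => ε i && (![a₀, a₁, a₂, a₃] : Fin 4 → Fin (6 + 6) → Bool) i j)))
    with hptdef
  have hin : ∀ ε, pt ε ∈ Z := fun ε => fr_mem_flatPt4 V₀ h0 (· ∈ Z) hPV hxZ ![a₀, a₁, a₂, a₃] (fun i => by fin_cases i <;> assumption) ε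
  set t₁ := bxor xZ b with ht₁
  have htr : ∀ ε, bxor (pt ε) t₁ = (fun j => b j ^^ decide (Odd #(univ.filter fun i =>
      ε i && (![a₀, a₁, a₂, a₃] : Fin 4 → Fin (6 + 6) → Bool) i j))) := by
    intro ε
    simp only [pt, t₁]
    rw [ws_flatPt_eq_bxor xZ, ws_flatPt_eq_bxor b]
    funext j; simp only [bxor]; cases xZ j <;> cases b j <;> simp
  -- the second direction `t₂`: the families `pt ⊕ t₂` and `pt ⊕ t₂ ⊕ t₁` must avoid `Z ∪ A` — forbid `F₁ ∪ F₁ ⊕ t₁`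
  set Bad₀ := (univ : Finset (Fin 4 → Bool)).biUnion (fun ε => A.image (bxor (pt ε))) with hBad₀
  have hBad₀card : #Bad₀ ≤ 1520 := by
    calc #Bad₀ ≤ ∑ ε : Fin 4 → Bool, #(A.image (bxor (pt ε))) := card_biUnion_le
      _ ≤ ∑ ε : Fin 4 → Bool, #A := sum_le_sum fun ε _ => card_image_le
      _ = 2 ^ 4 * #A := by rw [sum_const, card_univ, Fintype.card_fun, Fintype.card_bool, Fintype.card_fin, smul_eq_mul]
      _ ≤ 16 * 95 := Nat.mul_le_mul (le_refl _) hAcard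
      _ = 1520 := by norm_num
  set F₁ := V₀ ∪ Bad₀ with hF₁
  have hF₁card : #F₁ ≤ 2032 := (card_union_le _ _).trans (by rw [hcardV]; omega)
  have hgoodF : ∀ w, w ∉ F₁ → ∀ ε, bxor (pt ε) w ∉ Z ∧ bxor (pt ε) w ∉ A := by
    intro w hw ε
    rw [hF₁, mem_union, not_or] at hw
    refine ⟨fun h => hw.1 (gh_mem_dir V₀ Z xZ hadd hS (hin ε) h), fun h => hw.2 ?_⟩
    exact mem_biUnion.2 ⟨ε, mem_univ _, mem_image.2 ⟨bxor (pt ε) w, h, bxor_bxor_cancel_left _ _⟩⟩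
  have huniv : #(univ : Finset (Fin (6 + 6) → Bool)) = 4096 := by
    rw [card_univ, Fintype.card_fun, Fintype.card_bool, Fintype.card_fin]; norm_num
  obtain ⟨t₂, -, ht₂⟩ : ∃ t, t ∈ univ ∧ t ∉ F₁ ∪ F₁.image (fun z => bxor z t₁) :=
    exists_mem_notMem_of_card_lt_card (by
      have h1 := card_union_le F₁ (F₁.image (fun z => bxor z t₁))
      have h2 : #(F₁.image (fun z => bxor z t₁)) ≤ 2032 := card_image_le.trans hF₁card
      rw [huniv]; omega)
  rw [mem_union, not_or] at ht₂
  have ht₂₁ : bxor t₂ t₁ ∉ F₁ := fun hmem =>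
    ht₂.2 (mem_image.2 ⟨bxor t₂ t₁, hmem, by rw [iw_bxor_assoc, bxor_self, bxor_zeroVec]⟩)
  -- 6-flat sum with directions `t₁, t₂, a₀..a₃`, peeled twice
  have h6 := tw15_e_flat6 f g hf hg u'' hu'' xZ ![t₁, t₂, a₀, a₁, a₂, a₃]
  have h6' : (4 : ℤ) ∣ ∑ ε : Fin 6 → Bool, F' (fun j => xZ j ^^ decide (Odd #(univ.filter fun i =>
      ε i && (![t₁, t₂, a₀, a₁, a₂, a₃] : Fin 6 → Fin (6 + 6) → Bool) i j))) := by
    have hd : (4 : ℤ) ∣ ∑ ε : Fin 6 → Bool, ((u'' (fun j => xZ j ^^ decide (Odd #(univ.filter fun i =>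
        ε i && (![t₁, t₂, a₀, a₁, a₂, a₃] : Fin 6 → Fin (6 + 6) → Bool) i j))) - sZ (f (fun j => xZ j ^^ decide (Odd #(univ.filter fun i =>
        ε i && (![t₁, t₂, a₀, a₁, a₂, a₃] : Fin 6 → Fin (6 + 6) → Bool) i j))))) -
        F' (fun j => xZ j ^^ decide (Odd #(univ.filter fun i =>
        ε i && (![t₁, t₂, a₀, a₁, a₂, a₃] : Fin 6 → Fin (6 + 6) → Bool) i j)))) := dvd_sum fun ε _ => hdiffF _
    rw [sum_sub_distrib] at hd
    have := dvd_sub h6 hd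
    simpa using this
  have hpeel : ∑ ε : Fin 6 → Bool, F' (fun j => xZ j ^^ decide (Odd #(univ.filter fun i =>
      ε i && (![t₁, t₂, a₀, a₁, a₂, a₃] : Fin 6 → Fin (6 + 6) → Bool) i j))) =
      (∑ ε : Fin 4 → Bool, F' (pt ε) + ∑ ε : Fin 4 → Bool, F' (bxor (pt ε) t₂)) +
      (∑ ε : Fin 4 → Bool, F' (bxor (pt ε) t₁) + ∑ ε : Fin 4 → Bool, F' (bxor (bxor (pt ε) t₂) t₁)) := by
    have p1 := fr_sum_peel F' xZ t₁ ![t₂, a₀, a₁, a₂, a₃]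
    have p2 := fr_sum_peel F' xZ t₂ ![a₀, a₁, a₂, a₃]
    have p3 := fr_sum_peel (fun y => F' (bxor y t₁)) xZ t₂ ![a₀, a₁, a₂, a₃]
    beta_reduce at p3
    rw [p1, p2, p3]
  have hz2 : ∑ ε : Fin 4 → Bool, F' (bxor (pt ε) t₂) = 0 :=
    sum_eq_zero fun ε _ => hGF _ (hgoodF t₂ ht₂.1 ε).1 (hgoodF t₂ ht₂.1 ε).2
  have hz21 : ∑ ε : Fin 4 → Bool, F' (bxor (bxor (pt ε) t₂) t₁) = 0 := by
    refine sum_eq_zero fun ε _ => ?_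
    rw [iw_bxor_assoc]
    exact hGF _ (hgoodF _ ht₂₁ ε).1 (hgoodF _ ht₂₁ ε).2
  -- the base 4-flat in `Z` is `≡ 0 (mod 4)`
  have hbase : (4 : ℤ) ∣ ∑ ε : Fin 4 → Bool, F' (pt ε) := by
    rw [sum_congr rfl fun ε _ => hF'Z _ (hin ε)]
    exact tzc_four_flat_Z f g hf hg u'' hu'' V₀ xZ h0 hadd hcardV hS hoff' xZ hxZ a₀ a₁ a₂ a₃ ha₀ ha₁ ha₂ ha₃
  rw [hpeel, hz2, hz21, add_zero, add_zero] at h6'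
  have htarget : (4 : ℤ) ∣ ∑ ε : Fin 4 → Bool, F' (bxor (pt ε) t₁) := by
    have h := dvd_sub h6' hbase
    rwa [add_sub_cancel_left] at h
  -- back from `F'` to `e` on the target flat
  have hd : (4 : ℤ) ∣ ∑ ε : Fin 4 → Bool, (e (bxor (pt ε) t₁) - F' (bxor (pt ε) t₁)) := dvd_sum fun ε _ => hdiffF _
  rw [sum_sub_distrib] at hd
  have h := dvd_add htarget hd
  rw [add_sub_cancel] at h
  rw [sum_congr rfl fun ε _ => congrArg e (htr ε)] at h
  exact h

/-! ### The bad set `A₂ = {4 ∤ e}` off `Z`: empty or of energy `≥ 256` -/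

/-- **`A₂` meets an off-`Z` coset in `0` or `≥ 64` points** (off-flat energy `≤ 383`; gen 25's `gl_A_coset64` at `≤ 256`). [this work] -/
theorem tzc_A2_coset (f g : (Fin (6 + 6) → Bool) → Bool) (hf : IsDegLeFun 3 f) (hg : IsDegLeFun 3 g)
    (u'' : (Fin (6 + 6) → Bool) → ℤ) (hu'' : ∀ x, W (fun y => signOf (g y)) x = (2 : ℝ) ^ 6 * (u'' x : ℝ))
    (V₀ : Finset (Fin (6 + 6) → Bool)) (xZ : Fin (6 + 6) → Bool) (h0 : zeroVec ∈ V₀)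
    (hadd : ∀ a ∈ V₀, ∀ b ∈ V₀, bxor a b ∈ V₀) (hcardV : #V₀ = 512)
    (hS : (univ.filter fun x : Fin (6 + 6) → Bool => ¬ Odd (u'' x)) = V₀.image (bxor xZ))
    (hoff : ∑ y ∈ univ.filter (fun y => y ∉ (univ.filter fun x : Fin (6 + 6) → Bool => ¬ Odd (u'' x))), (u'' y - sZ (f y)) ^ 2 ≤ 383)
    (c : Fin (6 + 6) → Bool) (hc : c ∉ (univ.filter fun x : Fin (6 + 6) → Bool => ¬ Odd (u'' x))) :
    (∀ y ∈ V₀.image (bxor c), (4 : ℤ) ∣ u'' y - sZ (f y)) ∨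
      64 ≤ #((V₀.image (bxor c)).filter fun y => ¬ (4 : ℤ) ∣ u'' y - sZ (f y)) := by
  classical
  set Z := univ.filter (fun x : Fin (6 + 6) → Bool => ¬ Odd (u'' x)) with hZdef
  set e : (Fin (6 + 6) → Bool) → ℤ := fun x => u'' x - sZ (f x) with hedef
  have hcardV9 : #V₀ = 2 ^ 9 := by rw [hcardV]; norm_num
  have hPV' : ∀ x, x ∉ Z → ∀ a ∈ V₀, bxor x a ∉ Z := fun x hx a ha => fl1_coset_out' hadd hS hx ha
  have hcos_out : ∀ b ∈ V₀.image (bxor c), b ∉ Z := by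
    intro b hb
    obtain ⟨v, hv, rfl⟩ := mem_image.1 hb
    exact hPV' c hc v hv
  have hp2 : ∀ y, y ∉ Z → e y = 2 * (e y / 2) := fun y hy =>
    (Int.mul_ediv_cancel' (even_iff_two_dvd.1 (gh_even_off f u'' y hy))).symm
  rcases ws_erm_round V₀ h0 hadd hcardV9 c (fun y => e y / 2) 3 (fun b hb a ha => by
      have hpts : ∀ ε : Fin (3 + 1) → Bool, (fun j => b j ^^ decide (Odd #(univ.filter fun i => ε i && a i j))) ∉ Z :=
        fun ε => ws_flatPt_mem V₀ h0 (· ∉ Z) hPV' (3 + 1) b (hcos_out b hb) a ha ε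
      have h4 := tzc_line f g hf hg u'' hu'' V₀ xZ h0 hadd hcardV hS hoff b (a 0) (a 1) (a 2) (a 3) (ha 0) (ha 1) (ha 2) (ha 3)
      have ea : (![a 0, a 1, a 2, a 3] : Fin 4 → Fin (6 + 6) → Bool) = a := by
        funext i; fin_cases i <;> rfl
      rw [ea] at h4
      change (4 : ℤ) ∣ ∑ ε : Fin (3 + 1) → Bool, e (fun j => b j ^^ decide (Odd #(univ.filter fun i => ε i && a i j))) at h4
      rw [sum_congr rfl fun ε _ => hp2 _ (hpts ε), ← mul_sum] at h4
      obtain ⟨k, hk⟩ := h4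
      exact ⟨k, by linarith⟩) with hev | hbig
  · left
    intro y hy
    obtain ⟨k, hk⟩ := hev y hy
    have h2 := hp2 y (hcos_out y hy)
    refine ⟨k, ?_⟩
    simp only [e] at hk h2
    omega
  · right
    show 64 ≤ #((V₀.image (bxor c)).filter fun y => ¬ (4 : ℤ) ∣ e y)
    have e1 : ((V₀.image (bxor c)).filter fun x => Odd (e x / 2)) = (V₀.image (bxor c)).filter fun y => ¬ (4 : ℤ) ∣ e y := by
      refine filter_congr fun y hy => ?_
      have h2 := hp2 y (hcos_out y hy)
      constructor
      · intro hodd h4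
        obtain ⟨k, hk⟩ := h4
        rw [Int.odd_iff] at hodd
        omega
      · intro h4
        rw [Int.odd_iff]
        by_contra hne
        exact h4 ⟨e y / 2 / 2, by omega⟩
    rw [e1] at hbig
    norm_num at hbig
    omega

/-- **Dichotomy**: with off-flat energy `≤ 383`, EITHER `4 ∣ e` everywhere off `Z`, OR the off-flat energy is `≥ 256` (some off-`Z` coset
carries `≥ 64` points with `e ≡ 2 (mod 4)`, each costing `≥ 4`). [this work] -/
theorem tzc_A2_energy (f g : (Fin (6 + 6) → Bool) → Bool) (hf : IsDegLeFun 3 f) (hg : IsDegLeFun 3 g)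
    (u'' : (Fin (6 + 6) → Bool) → ℤ) (hu'' : ∀ x, W (fun y => signOf (g y)) x = (2 : ℝ) ^ 6 * (u'' x : ℝ))
    (V₀ : Finset (Fin (6 + 6) → Bool)) (xZ : Fin (6 + 6) → Bool) (h0 : zeroVec ∈ V₀)
    (hadd : ∀ a ∈ V₀, ∀ b ∈ V₀, bxor a b ∈ V₀) (hcardV : #V₀ = 512)
    (hS : (univ.filter fun x : Fin (6 + 6) → Bool => ¬ Odd (u'' x)) = V₀.image (bxor xZ))
    (hoff : ∑ y ∈ univ.filter (fun y => y ∉ (univ.filter fun x : Fin (6 + 6) → Bool => ¬ Odd (u'' x))), (u'' y - sZ (f y)) ^ 2 ≤ 383) :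
    (∀ y, y ∉ (univ.filter fun x : Fin (6 + 6) → Bool => ¬ Odd (u'' x)) → (4 : ℤ) ∣ u'' y - sZ (f y)) ∨
      256 ≤ ∑ y ∈ univ.filter (fun y => y ∉ (univ.filter fun x : Fin (6 + 6) → Bool => ¬ Odd (u'' x))), (u'' y - sZ (f y)) ^ 2 := by
  classical
  set Z := univ.filter (fun x : Fin (6 + 6) → Bool => ¬ Odd (u'' x)) with hZdef
  set e : (Fin (6 + 6) → Bool) → ℤ := fun x => u'' x - sZ (f x) with hedef
  by_cases hall : ∀ y, y ∉ Z → (4 : ℤ) ∣ e y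
  · exact Or.inl hall
  right
  push Not at hall
  obtain ⟨c, hc, hc4⟩ := hall
  have hPV' : ∀ x, x ∉ Z → ∀ a ∈ V₀, bxor x a ∉ Z := fun x hx a ha => fl1_coset_out' hadd hS hx ha
  rcases tzc_A2_coset f g hf hg u'' hu'' V₀ xZ h0 hadd hcardV hS hoff c hc with h4 | hbig
  · exact absurd (h4 c (mem_image.2 ⟨zeroVec, h0, bxor_zeroVec c⟩)) hc4
  · set M := (V₀.image (bxor c)).filter (fun y => ¬ (4 : ℤ) ∣ e y) with hMdef
    have hMsub : M ⊆ univ.filter (fun y => y ∉ Z) := by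
      intro y hy
      obtain ⟨hy1, -⟩ := mem_filter.1 hy
      obtain ⟨v, hv, rfl⟩ := mem_image.1 hy1
      exact mem_filter.2 ⟨mem_univ _, hPV' c hc v hv⟩
    have hcost : ∀ y ∈ M, (4 : ℤ) ≤ e y ^ 2 := by
      intro y hy
      obtain ⟨hy1, hy4⟩ := mem_filter.1 hy
      obtain ⟨v, hv, rfl⟩ := mem_image.1 hy1
      obtain ⟨m, hm⟩ := gh_even_off f u'' _ (hPV' c hc v hv)
      have hm0 : m ≠ 0 := by
        rintro rfl
        apply hy4
        rw [show e (bxor c v) = 0 from hm]; exact dvd_zero 4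
      change e (bxor c v) = m + m at hm
      have : e (bxor c v) ≤ -2 ∨ 2 ≤ e (bxor c v) := by omega
      have := tp_sq_ge (k := 2) (by norm_num) this
      linarith
    have h64 : (64 : ℤ) ≤ #M := by exact_mod_cast hbig
    calc (256 : ℤ) ≤ 4 * #M := by linarith
      _ = ∑ y ∈ M, (4 : ℤ) := by rw [sum_const, nsmul_eq_mul, mul_comm]
      _ ≤ ∑ y ∈ M, e y ^ 2 := sum_le_sum hcost
      _ ≤ ∑ y ∈ univ.filter (fun y => y ∉ Z), e y ^ 2 := sum_le_sum_of_subset_of_nonneg hMsub fun _ _ _ => sq_nonneg _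

end Summit.QuantumAdvantage.QuantumAdvantage.Theorems.CubicForrelation.NearExactIsExact

end
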